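import Summits.Ventures.PercRepro.C041TreeDict

/-!
# ROW C-041 — THE PATH ZONES: every «tree term» of mine-3's square reduction is the six-vector of an explicit zone
(p6, gen 31; C-041.md §21 (ah): `Θ_C = Θ_□ + p₁·ℓψ(w₃ℓψ(w₂ℓψ(w₁))) + p₂·ℓψ(w₁)ℓψ(w₃ℓψ(w₂)) + …`)

With THE EDGE DICTIONARY (`sixVec_edgePendant`) and Π multiplicative at the anchor (`sixVec_glue`), the nested
`ℓψ`-products of mine-3's closed form are six-vectors of explicit packages: `path2 A B` — the zone `B` behind the
zone `A` on a path of two edges from the anchor (`ℓψ(Π A · ℓψ(Π B))`), `path3 A B C` — three edges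
(`ℓψ(Π A · ℓψ(Π B · ℓψ(Π C)))`), `twoPend A B` — two edges from the anchor, one zone at the end of each
(`ℓψ(Π A) · ℓψ(Π B)`).  Every statement for every choice of the finiteness instances (`sixVec_path2'` …) and with
the inferred ones (`sixVec_path2` …).
-/

namespace PercRepro

namespace ZoneZ

namespace AZone

open ZoneData TreeClosure Pendant AnchorGlue PointZone Finset

/-- The zone `B` behind the zone `A` on a path of two edges from the anchor. -/
noncomputable abbrev path2 (A B : AZone) : AZone := edgePendant (glue A (edgePendant B))

/-- Three zones on a path of three edges from the anchor (`A` nearest). -/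
noncomputable abbrev path3 (A B C : AZone) : AZone := edgePendant (glue A (edgePendant (glue B (edgePendant C))))

/-- Two zones at the ends of two edges from the anchor. -/
noncomputable abbrev twoPend (A B : AZone) : AZone := glue (edgePendant A) (edgePendant B)

/-- A package with a known six-vector for every choice of the instances. -/
def HasVec (A : AZone) (F : Vec6) : Prop :=
  ∀ (iE : Fintype A.E) (dE : DecidableEq A.E) (i₁ : Fintype A.T₁) (d₁ : DecidableEq A.T₁) (i₂ : Fintype A.T₂)
    (d₂ : DecidableEq A.T₂), @sixVec _ _ _ _ A.Z A.k iE dE i₁ d₁ i₂ d₂ = F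

/-- The edge-pendant of a package with a known six-vector. -/
theorem HasVec.edgePendant {A : AZone} {F : Vec6} (h : HasVec A F) : HasVec (edgePendant A) (ellv F) :=
  fun iE dE i₁ d₁ i₂ d₂ => sixVec_edgePendant' A F h iE dE i₁ d₁ i₂ d₂

/-- The gluing of two packages with known six-vectors. -/
theorem HasVec.glue {A B : AZone} {FA FB : Vec6} (hA : HasVec A FA) (hB : HasVec B FB) :
    HasVec (glue A B) (FA * FB) :=
  fun iE dE i₁ d₁ i₂ d₂ => sixVec_glue' A B FA FB hA hB iE dE i₁ d₁ i₂ d₂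

/-- A package with its own instances has its own six-vector. -/
theorem hasVec_self (A : AZone) [jE : Fintype A.E] [eE : DecidableEq A.E] [j₁ : Fintype A.T₁]
    [e₁ : DecidableEq A.T₁] [j₂ : Fintype A.T₂] [e₂ : DecidableEq A.T₂] : HasVec A (A.Z.sixVec A.k) := by
  intro iE dE i₁ d₁ i₂ d₂
  obtain rfl : iE = jE := Subsingleton.elim _ _
  obtain rfl : dE = eE := Subsingleton.elim _ _
  obtain rfl : i₁ = j₁ := Subsingleton.elim _ _
  obtain rfl : d₁ = e₁ := Subsingleton.elim _ _
  obtain rfl : i₂ = j₂ := Subsingleton.elim _ _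
  obtain rfl : d₂ = e₂ := Subsingleton.elim _ _
  rfl

/-- `ℓψ(Π A · ℓψ(Π B))` is the six-vector of the two-edge path zone. -/
theorem HasVec.path2 {A B : AZone} {FA FB : Vec6} (hA : HasVec A FA) (hB : HasVec B FB) :
    HasVec (path2 A B) (ellv (FA * ellv FB)) :=
  (hA.glue hB.edgePendant).edgePendant

/-- `ℓψ(Π A · ℓψ(Π B · ℓψ(Π C)))` is the six-vector of the three-edge path zone. -/
theorem HasVec.path3 {A B C : AZone} {FA FB FC : Vec6} (hA : HasVec A FA) (hB : HasVec B FB) (hC : HasVec C FC) :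
    HasVec (path3 A B C) (ellv (FA * ellv (FB * ellv FC))) :=
  (hA.glue (hB.glue hC.edgePendant).edgePendant).edgePendant

/-- `ℓψ(Π A) · ℓψ(Π B)` is the six-vector of two pendant edges. -/
theorem HasVec.twoPend {A B : AZone} {FA FB : Vec6} (hA : HasVec A FA) (hB : HasVec B FB) :
    HasVec (twoPend A B) (ellv FA * ellv FB) :=
  hA.edgePendant.glue hB.edgePendant

variable (A B C : AZone) [Fintype A.E] [DecidableEq A.E] [Fintype A.T₁] [DecidableEq A.T₁] [Fintype A.T₂]
  [DecidableEq A.T₂] [Fintype B.E] [DecidableEq B.E] [Fintype B.T₁] [DecidableEq B.T₁] [Fintype B.T₂]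
  [DecidableEq B.T₂] [Fintype C.E] [DecidableEq C.E] [Fintype C.T₁] [DecidableEq C.T₁] [Fintype C.T₂]
  [DecidableEq C.T₂]

/-- **The two-edge path zone**: `Π(path2 A B) = ℓψ(Π A · ℓψ(Π B))`. -/
theorem sixVec_path2 : (path2 A B).Z.sixVec (path2 A B).k = ellv (A.Z.sixVec A.k * ellv (B.Z.sixVec B.k)) :=
  (hasVec_self A).path2 (hasVec_self B) _ _ _ _ _ _

/-- **The three-edge path zone**: `Π(path3 A B C) = ℓψ(Π A · ℓψ(Π B · ℓψ(Π C)))` — mine-3's `p₁`- and `p₄`-terms. -/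
theorem sixVec_path3 :
    (path3 A B C).Z.sixVec (path3 A B C).k =
      ellv (A.Z.sixVec A.k * ellv (B.Z.sixVec B.k * ellv (C.Z.sixVec C.k))) :=
  (hasVec_self A).path3 (hasVec_self B) (hasVec_self C) _ _ _ _ _ _

/-- **Two pendant edges**: `Π(twoPend A B) = ℓψ(Π A) · ℓψ(Π B)`. -/
theorem sixVec_twoPend : (twoPend A B).Z.sixVec (twoPend A B).k = ellv (A.Z.sixVec A.k) * ellv (B.Z.sixVec B.k) :=
  (hasVec_self A).twoPend (hasVec_self B) _ _ _ _ _ _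

/-- **A pendant edge and a two-edge path**: `ℓψ(Π A) · ℓψ(Π B · ℓψ(Π C))` — mine-3's `p₂`- and `p₃`-terms. -/
theorem sixVec_glue_edgePendant_path2 :
    (glue (edgePendant A) (path2 B C)).Z.sixVec (glue (edgePendant A) (path2 B C)).k =
      ellv (A.Z.sixVec A.k) * ellv (B.Z.sixVec B.k * ellv (C.Z.sixVec C.k)) :=
  ((hasVec_self A).edgePendant.glue ((hasVec_self B).path2 (hasVec_self C))) _ _ _ _ _ _

end AZone

end ZoneZ

end PercRepro
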